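import Literature.InformationTheory.QuantumCodes.DistanceFailureFloorDepolarizing
import Summits.Ventures.QEC.Thresholds.BBDistanceFloors
import HarnessLib

/-!
# Certified FLOORS on the logical error rate of the five Bravyi-et-al. bivariate-bicycle codes under DEPOLARIZING
# noise, every pair of sector decoders: `[[72,12,6]]`, `[[90,8,10]]`, `[[108,8,10]]`, `[[144,12,12]]`, `[[288,12,18]]`

Venture QEC, `Summits/Ventures/QEC/Thresholds/` (LADDER-QEC rungs Q2/Q4/Q5; qec-lit-2 gen 6). HONEST FRAMING. The
depolarizing column of `BBDistanceFloors.lean`: `Literature/…/DistanceFailureFloorDepolarizing.lean` proves, for every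
CSS code with `k ≥ 1`, EVERY PAIR OF SECTOR DECODERS (the `Z`-syndrome decoder applied to the bit-flip part, the
`X`-syndrome decoder to the phase-flip part — the decoders of every census depolarizing row,
`CSSCode.depolarizingFailureProb`) and depolarizing rate `0 ≤ p ≤ 3/4`, the floor
`½·C(d,⌈d/2⌉)·(2p/3)^{⌈d/2⌉}(1−2p/3)^{⌊d/2⌋} ≤ P^{depol}_p` with `d ∈ {d^Z, d^X}` (the phase-flip part of a depolarizing
error is i.i.d. of rate `2p/3`, Dennis et al. §4.1; "`L/2` errors could suffice", §3). Fed with the KERNEL distance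
certificates of [BravyiEtAl2024] Table 1 (`BB72_12_6_claim_holds`, `BB90_8_10_claim_holds`, `BB108_8_10_claim_holds`,
`BB144_12_12_claim_holds`, `BB288_12_18_claim_holds_std`; all axioms standard), every row below is an UNCONDITIONAL
kernel theorem about the named code, valid for every pair of sector decoders (`0 ≤ p ≤ 3/4`, `s := 2p/3`):

| code | depolarizing floor |
|---|---|
| `[[72,12,6]]`   | `10 · s³(1−s)³ ≤ P^{depol}_p`    |
| `[[90,8,10]]`   | `126 · s⁵(1−s)⁵ ≤ P^{depol}_p`   |
| `[[108,8,10]]`  | `126 · s⁵(1−s)⁵ ≤ P^{depol}_p`   |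
| `[[144,12,12]]` | `462 · s⁶(1−s)⁶ ≤ P^{depol}_p`   |
| `[[288,12,18]]` | `24310 · s⁹(1−s)⁹ ≤ P^{depol}_p` |

(gross code at `p = 10⁻³`, `s = 6.67·10⁻⁴`: `P^{depol} ≥ 4.0·10⁻¹⁷`, any sector-decoder pair). FLOOR counterparts of the
DKP15 depolarizing CEILINGS of `BBDepolarizingBounds.lean`; floor and ceiling never merged; no Monte Carlo value; joint
decoders exploiting `X/Z` correlations are outside `depolarizingFailureProb` and not claimed. Generic census form
`BB.distanceFloor_le_depolarizingFailureProb_of_hasParams` for any discharged `HasParams C n k d`, `k ≥ 1`.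

## References

* [DennisEtAl2002] Dennis–Kitaev–Landahl–Preskill, J. Math. Phys. 43 (2002) 4452, §3 ("L/2 errors"), §4.1
  (depolarizing channel, X and Z treated separately), §4.3.
* [BravyiEtAl2024] S. Bravyi et al., Nature 627 (2024) 778, Table 1 (the five codes), Lemma 1 (`d = d^X = d^Z`).
-/

noncomputable section

namespace Summit.Ventures.QEC.Thresholds

open Finset Matrix
open Literature.InformationTheory.QuantumCodes
open Summit.Ventures.QEC.BB

/-! ### Generic census form -/

section Generic

variable {ℓ m : ℕ} [NeZero ℓ] [NeZero m]

/-- **Census form, depolarizing**: a bivariate-bicycle code with discharged parameters `[[n,k,d]]`, `k ≥ 1`, has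
`½·C(d,⌈d/2⌉)·(2p/3)^{⌈d/2⌉}(1−2p/3)^{⌊d/2⌋} ≤ P^{depol}_p[D_X, D_Z]` for EVERY pair of sector decoders (`0 ≤ p ≤ 3/4`).
[cite: DennisEtAl2002, §4.1 and §3; BravyiEtAl2024, Lemma 1 (d = d^X = d^Z)] -/
theorem BB.distanceFloor_le_depolarizingFailureProb_of_hasParams (C : BB.Code ℓ m) {n k d : ℕ}
    (h : HasParams C n k d) (hk : 0 < k)
    (DX DZ : Decoder (BB.Mono ℓ m → ZMod 2) (BB.Mono ℓ m ⊕ BB.Mono ℓ m → ZMod 2)) {p : ℝ} (hp0 : 0 ≤ p)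
    (hp : p ≤ 3 / 4) :
    1 / 2 * ((d.choose ((d + 1) / 2) : ℝ) * ((2 * p / 3) ^ ((d + 1) / 2) * (1 - 2 * p / 3) ^ (d / 2))) ≤
      C.css.depolarizingFailureProb DX DZ p := by
  have hkC : 0 < C.css.k := by
    have : C.css.k = k := h.2.1
    omega
  have hf := C.css.distanceFloor_dZ_le_depolarizingFailureProb hkC DX DZ hp0 hp
  rw [(dX_eq_of_hasParams h).2] at hf
  exact hf

/-- Cruder census form: `½·(2p/3)^d ≤ P^{depol}_p` for every pair of sector decoders (`k ≥ 1`, `0 ≤ p ≤ 3/4`).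
[cite: DennisEtAl2002, §4.1 and §3; BravyiEtAl2024, Lemma 1] -/
theorem BB.half_pow_le_depolarizingFailureProb_of_hasParams (C : BB.Code ℓ m) {n k d : ℕ}
    (h : HasParams C n k d) (hk : 0 < k)
    (DX DZ : Decoder (BB.Mono ℓ m → ZMod 2) (BB.Mono ℓ m ⊕ BB.Mono ℓ m → ZMod 2)) {p : ℝ} (hp0 : 0 ≤ p)
    (hp : p ≤ 3 / 4) :
    1 / 2 * (2 * p / 3) ^ d ≤ C.css.depolarizingFailureProb DX DZ p := by
  have hkC : 0 < C.css.k := by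
    have : C.css.k = k := h.2.1
    omega
  have hf := C.css.half_pow_dZ_le_depolarizingFailureProb hkC DX DZ hp0 hp
  rw [(dX_eq_of_hasParams h).2] at hf
  exact hf

end Generic

/-! ### The five codes of Bravyi et al., Table 1 — unconditional (KERNEL distance certificates) -/

/-- **`[[72,12,6]]`, depolarizing, every sector-decoder pair**: `10·s³(1−s)³ ≤ P^{depol}_p`, `s = 2p/3`
(`0 ≤ p ≤ 3/4`). UNCONDITIONAL (`BB72_12_6_claim_holds`). [cite: DennisEtAl2002, §4.1 and §3; BravyiEtAl2024, Table 1 row [[72,12,6]]] -/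
theorem bb72_depolarizingFloor (DX DZ : Decoder (BB.Mono 6 6 → ZMod 2) (BB.Mono 6 6 ⊕ BB.Mono 6 6 → ZMod 2))
    {p : ℝ} (hp0 : 0 ≤ p) (hp : p ≤ 3 / 4) :
    10 * ((2 * p / 3) ^ 3 * (1 - 2 * p / 3) ^ 3) ≤ BB.bb72.css.depolarizingFailureProb DX DZ p := by
  have hZ := BB.distanceFloor_le_depolarizingFailureProb_of_hasParams BB.bb72 Census.BB72.BB72_12_6_claim_holds
    (by norm_num) DX DZ hp0 hp
  have hc : ((Nat.choose 6 ((6 + 1) / 2) : ℕ) : ℝ) = 20 := by exact_mod_cast (by decide : Nat.choose 6 ((6 + 1) / 2) = 20)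
  rw [hc] at hZ
  linarith

/-- **`[[90,8,10]]`, depolarizing, every sector-decoder pair**: `126·s⁵(1−s)⁵ ≤ P^{depol}_p`, `s = 2p/3`
(`0 ≤ p ≤ 3/4`). UNCONDITIONAL (`BB90_8_10_claim_holds`). [cite: DennisEtAl2002, §4.1 and §3; BravyiEtAl2024, Table 1 row [[90,8,10]]] -/
theorem bb90_depolarizingFloor (DX DZ : Decoder (BB.Mono 15 3 → ZMod 2) (BB.Mono 15 3 ⊕ BB.Mono 15 3 → ZMod 2))
    {p : ℝ} (hp0 : 0 ≤ p) (hp : p ≤ 3 / 4) :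
    126 * ((2 * p / 3) ^ 5 * (1 - 2 * p / 3) ^ 5) ≤ BB.bb90.css.depolarizingFailureProb DX DZ p := by
  have hZ := BB.distanceFloor_le_depolarizingFailureProb_of_hasParams BB.bb90 Census.BB90.BB90_8_10_claim_holds
    (by norm_num) DX DZ hp0 hp
  have hc : ((Nat.choose 10 ((10 + 1) / 2) : ℕ) : ℝ) = 252 := by
    exact_mod_cast (by decide : Nat.choose 10 ((10 + 1) / 2) = 252)
  rw [hc] at hZ
  linarith

/-- **`[[108,8,10]]`, depolarizing, every sector-decoder pair**: `126·s⁵(1−s)⁵ ≤ P^{depol}_p`, `s = 2p/3`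
(`0 ≤ p ≤ 3/4`). UNCONDITIONAL (`BB108_8_10_claim_holds`). [cite: DennisEtAl2002, §4.1 and §3; BravyiEtAl2024, Table 1 row [[108,8,10]]] -/
theorem bb108_depolarizingFloor (DX DZ : Decoder (BB.Mono 9 6 → ZMod 2) (BB.Mono 9 6 ⊕ BB.Mono 9 6 → ZMod 2))
    {p : ℝ} (hp0 : 0 ≤ p) (hp : p ≤ 3 / 4) :
    126 * ((2 * p / 3) ^ 5 * (1 - 2 * p / 3) ^ 5) ≤ BB.bb108.css.depolarizingFailureProb DX DZ p := by
  have hZ := BB.distanceFloor_le_depolarizingFailureProb_of_hasParams BB.bb108 Census.BB108.BB108_8_10_claim_holds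
    (by norm_num) DX DZ hp0 hp
  have hc : ((Nat.choose 10 ((10 + 1) / 2) : ℕ) : ℝ) = 252 := by
    exact_mod_cast (by decide : Nat.choose 10 ((10 + 1) / 2) = 252)
  rw [hc] at hZ
  linarith

/-- **`[[144,12,12]]` (the gross code), depolarizing, every sector-decoder pair**: `462·s⁶(1−s)⁶ ≤ P^{depol}_p`,
`s = 2p/3` (`0 ≤ p ≤ 3/4`; e.g. `p = 10⁻³`: `≥ 4.0·10⁻¹⁷`). UNCONDITIONAL (`BB144_12_12_claim_holds`).
[cite: DennisEtAl2002, §4.1 and §3; BravyiEtAl2024, Table 1 row [[144,12,12]]] -/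
theorem bb144_depolarizingFloor (DX DZ : Decoder (BB.Mono 12 6 → ZMod 2) (BB.Mono 12 6 ⊕ BB.Mono 12 6 → ZMod 2))
    {p : ℝ} (hp0 : 0 ≤ p) (hp : p ≤ 3 / 4) :
    462 * ((2 * p / 3) ^ 6 * (1 - 2 * p / 3) ^ 6) ≤ BB.bb144.css.depolarizingFailureProb DX DZ p := by
  have hZ := BB.distanceFloor_le_depolarizingFailureProb_of_hasParams BB.bb144 Census.BB144.BB144_12_12_claim_holds
    (by norm_num) DX DZ hp0 hp
  have hc : ((Nat.choose 12 ((12 + 1) / 2) : ℕ) : ℝ) = 924 := by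
    exact_mod_cast (by decide : Nat.choose 12 ((12 + 1) / 2) = 924)
  rw [hc] at hZ
  linarith

/-- **`[[288,12,18]]`, depolarizing, every sector-decoder pair**: `24310·s⁹(1−s)⁹ ≤ P^{depol}_p`, `s = 2p/3`
(`0 ≤ p ≤ 3/4`). UNCONDITIONAL (`BB288_12_18_claim_holds_std`, the covering certificate).
[cite: DennisEtAl2002, §4.1 and §3; BravyiEtAl2024, Table 1 row [[288,12,18]]] -/
theorem bb288_depolarizingFloor (DX DZ : Decoder (BB.Mono 12 12 → ZMod 2) (BB.Mono 12 12 ⊕ BB.Mono 12 12 → ZMod 2))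
    {p : ℝ} (hp0 : 0 ≤ p) (hp : p ≤ 3 / 4) :
    24310 * ((2 * p / 3) ^ 9 * (1 - 2 * p / 3) ^ 9) ≤ BB.bb288.css.depolarizingFailureProb DX DZ p := by
  have hZ := BB.distanceFloor_le_depolarizingFailureProb_of_hasParams BB.bb288 Census.BB288.BB288_12_18_claim_holds_std
    (by norm_num) DX DZ hp0 hp
  have hc : ((Nat.choose 18 ((18 + 1) / 2) : ℕ) : ℝ) = 48620 := by
    exact_mod_cast (by decide : Nat.choose 18 ((18 + 1) / 2) = 48620)
  rw [hc] at hZ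
  linarith

/-- **The five depolarizing floors together** (every sector-decoder pair of each code, `0 ≤ p ≤ 3/4`, `s = 2p/3`).
[cite: DennisEtAl2002, §4.1 and §3; BravyiEtAl2024, Table 1] -/
theorem bb_depolarizingFloors {p : ℝ} (hp0 : 0 ≤ p) (hp : p ≤ 3 / 4)
    (D72 D72' : Decoder (BB.Mono 6 6 → ZMod 2) (BB.Mono 6 6 ⊕ BB.Mono 6 6 → ZMod 2))
    (D90 D90' : Decoder (BB.Mono 15 3 → ZMod 2) (BB.Mono 15 3 ⊕ BB.Mono 15 3 → ZMod 2))
    (D108 D108' : Decoder (BB.Mono 9 6 → ZMod 2) (BB.Mono 9 6 ⊕ BB.Mono 9 6 → ZMod 2))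
    (D144 D144' : Decoder (BB.Mono 12 6 → ZMod 2) (BB.Mono 12 6 ⊕ BB.Mono 12 6 → ZMod 2))
    (D288 D288' : Decoder (BB.Mono 12 12 → ZMod 2) (BB.Mono 12 12 ⊕ BB.Mono 12 12 → ZMod 2)) :
    10 * ((2 * p / 3) ^ 3 * (1 - 2 * p / 3) ^ 3) ≤ BB.bb72.css.depolarizingFailureProb D72 D72' p ∧
      126 * ((2 * p / 3) ^ 5 * (1 - 2 * p / 3) ^ 5) ≤ BB.bb90.css.depolarizingFailureProb D90 D90' p ∧
      126 * ((2 * p / 3) ^ 5 * (1 - 2 * p / 3) ^ 5) ≤ BB.bb108.css.depolarizingFailureProb D108 D108' p ∧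
      462 * ((2 * p / 3) ^ 6 * (1 - 2 * p / 3) ^ 6) ≤ BB.bb144.css.depolarizingFailureProb D144 D144' p ∧
      24310 * ((2 * p / 3) ^ 9 * (1 - 2 * p / 3) ^ 9) ≤ BB.bb288.css.depolarizingFailureProb D288 D288' p :=
  ⟨bb72_depolarizingFloor D72 D72' hp0 hp, bb90_depolarizingFloor D90 D90' hp0 hp,
    bb108_depolarizingFloor D108 D108' hp0 hp, bb144_depolarizingFloor D144 D144' hp0 hp,
    bb288_depolarizingFloor D288 D288' hp0 hp⟩

end Summit.Ventures.QEC.Thresholds
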